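import Literature.Barriers.CriticalPhenomena.TimarProcessMeasurable
import Literature.Barriers.CriticalPhenomena.TimarBranchingLemma
import HarnessLib

/-!
# Timár 2006, proof of Thm. 4.3: the moment recursions of the mass process and the survival of
# the branching construction (Lemma 4.1 applied) — PROVED

Barrier catalogue `Literature/Barriers/CriticalPhenomena/`; continues
`TimarProcessMeasurable.lean` towards `Timar2006_noInfiniteLightClusters_holds`. Á. Timár, Ann.
Probab. 34 (2006) 2344–2364: the proof of Thm. 4.3 (p. 2356) ends with "Hence, Lemma 4.1
applies to the random tree `T` defined above, with `p = q/2δ`. The nonextinction of `T` means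
that the corresponding vertices in `G` all belong to one (infinite) open cluster", and the proof
of Lemma 4.1 (p. 2352) is the second-moment computation
"`E[X²] ≤ Σ_{i,j} E[X_i]E[X_j] + αk²n` … `E[Y_m²] ≤ E[Y²_{m−1}] + αk² E[Y_{m−1}] (pk)^{−m−1}`".
Here, for the weighted generations `Y_g = timarPop` (weights `θ_g(x)` = inverse mean offspring
numbers, `θ ≤ a⁻¹`, `a > 1` the uniform lower bound of the mean offspring number):

* `lintegral_timarPop_succ`, `lintegral_timarPop` — `E Y_{g+1} = E Y_g = 1` (the martingale
  property; generation `g` is independent of its offspring numbers,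
  `lintegral_mass_mul_offspring₁`);
* `lintegral_timarPop_sq_succ_le` — `E Y²_{g+1} ≤ E Y²_g + a⁻¹ M α · a^{−g}`, `M = |B(o, ρ)|` the
  offspring bound and `α = |B(o, 2ρ+2)|` the dependency range ("the number of different `B_y`'s
  that intersect a fixed `B_x` is at most `|B(x, 2r)| =: α`", p. 2355): the printed computation,
  with far pairs factorised (`lintegral_offspring_mul_offspring_of_far`) and close pairs bounded;
* `timarPop_pos_measure_forall_ne_zero` — hence, by the second-moment core of Lemma 4.1
  (`measure_forall_ne_zero_pos_of_moments`, applied to `Z_g = a^g Y_g`),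
  `P[Y_g ≠ 0 for all g] > 0`: the tree survives with positive probability.

## References

* Á. Timár, Ann. Probab. 34 (2006) 2344–2364 (arXiv:math/0702875), §4: Lemma 4.1 and its proof
  (p. 2352), proof of Thm. 4.3 (pp. 2355–2356). [Timar2006]
-/

noncomputable section

namespace Literature.Barriers.CriticalPhenomena

open _root_.MeasureTheory _root_.ProbabilityTheory Literature.Probability.Percolation
open scoped _root_.ENNReal

variable {V : Type*}

/-! ### Balls of a transitive graph all have the same size -/

/-- On a transitive graph `|B(x, R)| = |B(y, R)|`. [folklore] -/
theorem encard_graphBall_eq_of_isGraphTransitive {G : SimpleGraph V} (htr : IsGraphTransitive G)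
    (x y : V) (R : ℕ) : (graphBall G x R).encard = (graphBall G y R).encard := by
  obtain ⟨γ, hγ⟩ := htr x y
  have himg : γ '' graphBall G x R = graphBall G y R := by
    ext v
    constructor
    · rintro ⟨u, hu, rfl⟩
      rw [← hγ]; exact mem_graphBall_map γ hu
    · intro hv
      refine ⟨γ.symm v, ?_, γ.apply_symm_apply v⟩
      have h := mem_graphBall_map γ.symm hv
      rwa [← hγ, γ.symm_apply_apply] at h
  rw [← himg, (γ.injective.injOn).encard_image]

/-- `(Σ' x, f x)² = Σ' x, Σ' y, f x · f y` in `ℝ≥0∞`. [folklore] -/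
theorem ennreal_tsum_sq_eq {ι : Type*} (f : ι → ℝ≥0∞) :
    (∑' x, f x) ^ 2 = ∑' x, ∑' y, f x * f y := by
  rw [sq, ← ENNReal.tsum_mul_right]
  exact tsum_congr fun x => ENNReal.tsum_mul_left.symm

section Moments

variable {G : SimpleGraph V} [G.LocallyFinite] {o : V} {n ρ : ℕ} {θ : ℕ → V → ℝ≥0∞}
variable (hconn : G.Connected) (htr : IsGraphTransitive G) (hU : ¬ IsGraphUnimodular G)
variable [Countable V] (p : unitInterval)
include hconn htr hU

omit [Countable V] in
/-- Off the slab of generation `g` the mass `m_g` vanishes identically. [folklore] -/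
theorem timarMass_eq_zero_of_not_mem_slab {g : ℕ} {x : V} (hx : x ∉ slab G o (g * (n + 2)))
    (ω : BondConfig V) : timarMass G o n ρ θ ω g x = 0 := by
  by_contra h
  exact hx (mem_of_timarMass_ne_zero hconn htr hU ω g h).1

/-- **The martingale step `E Y_{g+1} = E Y_g`**: generation `g` is independent of its offspring
numbers, whose means the weights `θ_g` invert on the slab of generation `g`.
[cite: Timar2006, §4 (proof of Lemma 4.1: E[Y_m] = E[Y_{m-1}] = 1)] -/
theorem lintegral_timarPop_succ
    (hmean : ∀ g x, x ∈ slab G o (g * (n + 2)) → θ g x *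
      ∫⁻ ω, ((timarChildren G o (g * (n + 2)) n ρ x ω).encard : ℝ≥0∞) ∂(bondPercolation G p) = 1)
    (g : ℕ) :
    ∫⁻ ω, timarPop G o n ρ θ ω (g + 1) ∂(bondPercolation G p) =
      ∫⁻ ω, timarPop G o n ρ θ ω g ∂(bondPercolation G p) := by
  simp only [timarPop_succ]
  have hmeasA : ∀ x, Measurable fun ω => timarMass G o n ρ θ ω g x * θ g x *
      ((timarChildren G o (g * (n + 2)) n ρ x ω).encard : ℝ≥0∞) := fun x =>
    ((measurable_timarMass g x).mul_const _).mul (measurable_encard_timarChildren _ n ρ x)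
  rw [lintegral_tsum fun x => (hmeasA x).aemeasurable]
  rw [timarPop_def_lintegral]
  · refine tsum_congr fun x => ?_
    by_cases hx : x ∈ slab G o (g * (n + 2))
    · -- `E[m θ N] = θ E[m] E[N] = E[m]`
      have hmN : Measurable fun ω => timarMass G o n ρ θ ω g x *
          ((timarChildren G o (g * (n + 2)) n ρ x ω).encard : ℝ≥0∞) :=
        (measurable_timarMass g x).mul (measurable_encard_timarChildren _ n ρ x)
      have h1 : ∫⁻ ω, timarMass G o n ρ θ ω g x * θ g x *
          ((timarChildren G o (g * (n + 2)) n ρ x ω).encard : ℝ≥0∞) ∂(bondPercolation G p) =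
          θ g x * ∫⁻ ω, timarMass G o n ρ θ ω g x *
            ((timarChildren G o (g * (n + 2)) n ρ x ω).encard : ℝ≥0∞) ∂(bondPercolation G p) := by
        rw [← lintegral_const_mul _ hmN]
        exact lintegral_congr fun ω => by ring
      rw [h1, lintegral_mass_mul_offspring₁ hconn htr hU p g x, ← mul_assoc, mul_comm (θ g x),
        mul_assoc, hmean g x hx, mul_one]
    · have h0 : ∀ ω, timarMass G o n ρ θ ω g x = 0 :=
        timarMass_eq_zero_of_not_mem_slab hconn htr hU hx
      simp only [h0, zero_mul, lintegral_const, zero_mul]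
  where
  /-- `E Y_g = Σ_x E m_g(x)`. -/
  timarPop_def_lintegral :
      ∫⁻ ω, timarPop G o n ρ θ ω g ∂(bondPercolation G p) =
        ∑' x, ∫⁻ ω, timarMass G o n ρ θ ω g x ∂(bondPercolation G p) := by
    simp only [timarPop]
    exact lintegral_tsum fun x => (measurable_timarMass g x).aemeasurable

/-- **`E Y_g = 1` for every generation.** [cite: Timar2006, §4 (proof of Lemma 4.1: E[Y_m] = 1)] -/
theorem lintegral_timarPop
    (hmean : ∀ g x, x ∈ slab G o (g * (n + 2)) → θ g x *
      ∫⁻ ω, ((timarChildren G o (g * (n + 2)) n ρ x ω).encard : ℝ≥0∞) ∂(bondPercolation G p) = 1) :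
    ∀ g : ℕ, ∫⁻ ω, timarPop G o n ρ θ ω g ∂(bondPercolation G p) = 1
  | 0 => by simp only [timarPop_zero, lintegral_const, measure_univ, mul_one]
  | g + 1 => by rw [lintegral_timarPop_succ hconn htr hU p hmean g, lintegral_timarPop hmean g]

omit hconn hU [Countable V] in
/-- The offspring number of any vertex is at most `M = |B(o, ρ)|` (children lie in `B(x, ρ)`,
and balls of a transitive graph have equal sizes). [cite: Timar2006, §4 (proof of Thm. 4.3: "there is a uniform bound on the sizes of the B_x")] -/
theorem encard_timarChildren_le (b : ℕ) (x : V) (ω : BondConfig V) :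
    ((timarChildren G o b n ρ x ω).encard : ℝ≥0∞) ≤ (graphBall G o ρ).encard := by
  rw [encard_graphBall_eq_of_isGraphTransitive htr o x ρ]
  exact_mod_cast Set.encard_le_encard (timarChildren_subset_graphBall b n ρ x ω)

/-- **The pair terms of `E Y²_{g+1}`**: for every `x, y`,
`E[A_x A_y] ≤ E[m_g(x) m_g(y)] + 1_{y ∈ B(x, 2ρ+2)} · a⁻¹ M a^{−g} E[m_g(x)]`, where
`A_x = m_g(x) θ_g(x) N_x` (far pairs factorise and `θ E N ≤ 1`; close pairs use `N_y ≤ M`,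
`θ ≤ a⁻¹` and `m_g ≤ a^{−g}`). [cite: Timar2006, §4 (proof of Lemma 4.1: E[X²] ≤ Σ E[X_i]E[X_j] + αk²n)] -/
theorem lintegral_pair_le {a : ℝ≥0∞} (hθ : ∀ g x, θ g x ≤ a⁻¹)
    (hmean_le : ∀ g x, θ g x *
      ∫⁻ ω, ((timarChildren G o (g * (n + 2)) n ρ x ω).encard : ℝ≥0∞) ∂(bondPercolation G p) ≤ 1)
    (g : ℕ) (x y : V) :
    ∫⁻ ω, (timarMass G o n ρ θ ω g x * θ g x *
        ((timarChildren G o (g * (n + 2)) n ρ x ω).encard : ℝ≥0∞)) *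
      (timarMass G o n ρ θ ω g y * θ g y *
        ((timarChildren G o (g * (n + 2)) n ρ y ω).encard : ℝ≥0∞)) ∂(bondPercolation G p) ≤
      ∫⁻ ω, timarMass G o n ρ θ ω g x * timarMass G o n ρ θ ω g y ∂(bondPercolation G p) +
        (graphBall G x (ρ + 1 + (ρ + 1))).indicator
          (fun _ => a⁻¹ * (graphBall G o ρ).encard * a⁻¹ ^ g *
            ∫⁻ ω, timarMass G o n ρ θ ω g x ∂(bondPercolation G p)) y := by
  -- notation
  set P := bondPercolation G p with hP
  set m : V → BondConfig V → ℝ≥0∞ := fun z ω => timarMass G o n ρ θ ω g z with hm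
  set N : V → BondConfig V → ℝ≥0∞ := fun z ω =>
    ((timarChildren G o (g * (n + 2)) n ρ z ω).encard : ℝ≥0∞) with hN
  have hmeas_m : ∀ z, Measurable (m z) := fun z => measurable_timarMass g z
  have hmeas_N : ∀ z, Measurable (N z) := fun z => measurable_encard_timarChildren _ n ρ z
  -- factor the constants and the generation/offspring independence
  have hmeas4 : Measurable fun ω => m x ω * m y ω * (N x ω * N y ω) :=
    ((hmeas_m x).mul (hmeas_m y)).mul ((hmeas_N x).mul (hmeas_N y))
  have hfac : ∫⁻ ω, (m x ω * θ g x * N x ω) * (m y ω * θ g y * N y ω) ∂P =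
      θ g x * θ g y * ((∫⁻ ω, m x ω * m y ω ∂P) * ∫⁻ ω, N x ω * N y ω ∂P) := by
    have hind := lintegral_mass_mul_offspring (o := o) (n := n) (ρ := ρ) (θ := θ) hconn htr hU p g x y
    change ∫⁻ ω, m x ω * m y ω * (N x ω * N y ω) ∂P =
      (∫⁻ ω, m x ω * m y ω ∂P) * ∫⁻ ω, N x ω * N y ω ∂P at hind
    rw [← hind, ← lintegral_const_mul _ hmeas4]
    exact lintegral_congr fun ω => by ring
  change ∫⁻ ω, (m x ω * θ g x * N x ω) * (m y ω * θ g y * N y ω) ∂P ≤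
    ∫⁻ ω, m x ω * m y ω ∂P + (graphBall G x (ρ + 1 + (ρ + 1))).indicator
      (fun _ => a⁻¹ * (graphBall G o ρ).encard * a⁻¹ ^ g * ∫⁻ ω, m x ω ∂P) y
  rw [hfac]
  by_cases hfar : y ∈ graphBall G x (ρ + 1 + (ρ + 1))
  · -- close pair: `E[N_x N_y] ≤ M E[N_x]`, `θ_x E N_x ≤ 1`, `θ_y ≤ a⁻¹`, `m_y ≤ a^{-g}`
    rw [Set.indicator_of_mem hfar]
    refine le_add_left ?_
    have h1 : ∫⁻ ω, N x ω * N y ω ∂P ≤ (graphBall G o ρ).encard * ∫⁻ ω, N x ω ∂P := by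
      rw [← lintegral_const_mul _ (hmeas_N x)]
      refine lintegral_mono fun ω => ?_
      rw [mul_comm]
      gcongr
      exact encard_timarChildren_le htr _ y ω
    have h2 : ∫⁻ ω, m x ω * m y ω ∂P ≤ a⁻¹ ^ g * ∫⁻ ω, m x ω ∂P := by
      rw [← lintegral_const_mul _ (hmeas_m x)]
      refine lintegral_mono fun ω => ?_
      rw [mul_comm]
      gcongr
      exact timarMass_le_pow hconn htr hU hθ ω g y
    calc θ g x * θ g y * ((∫⁻ ω, m x ω * m y ω ∂P) * ∫⁻ ω, N x ω * N y ω ∂P)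
        ≤ θ g x * a⁻¹ * ((a⁻¹ ^ g * ∫⁻ ω, m x ω ∂P) *
            ((graphBall G o ρ).encard * ∫⁻ ω, N x ω ∂P)) := by gcongr; exact hθ g y
      _ = a⁻¹ * (graphBall G o ρ).encard * a⁻¹ ^ g * (∫⁻ ω, m x ω ∂P) *
            (θ g x * ∫⁻ ω, N x ω ∂P) := by ring
      _ ≤ a⁻¹ * (graphBall G o ρ).encard * a⁻¹ ^ g * (∫⁻ ω, m x ω ∂P) * 1 := by
            gcongr; exact hmean_le g x
      _ = a⁻¹ * (graphBall G o ρ).encard * a⁻¹ ^ g * ∫⁻ ω, m x ω ∂P := mul_one _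
  · -- far pair: `E[N_x N_y] = E N_x · E N_y` and `θ E N ≤ 1` twice
    rw [Set.indicator_of_notMem hfar, add_zero,
      lintegral_offspring_mul_offspring_of_far p _ n ρ hfar]
    calc θ g x * θ g y * ((∫⁻ ω, m x ω * m y ω ∂P) * ((∫⁻ ω, N x ω ∂P) * ∫⁻ ω, N y ω ∂P))
        = (∫⁻ ω, m x ω * m y ω ∂P) * ((θ g x * ∫⁻ ω, N x ω ∂P) * (θ g y * ∫⁻ ω, N y ω ∂P)) := by
          ring
      _ ≤ (∫⁻ ω, m x ω * m y ω ∂P) * (1 * 1) := by gcongr <;> exact hmean_le g _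
      _ = ∫⁻ ω, m x ω * m y ω ∂P := by rw [mul_one, mul_one]

/-- **The second-moment recursion** `E Y²_{g+1} ≤ E Y²_g + a⁻¹ M α a^{−g} · E Y_g`
(`M = |B(o, ρ)|`, `α = |B(o, 2ρ+2)|`; "`E[Y_m²] ≤ E[Y²_{m−1}] + αk² E[Y_{m−1}](pk)^{−m−1}`",
p. 2352). [cite: Timar2006, §4 (proof of Lemma 4.1: the bound on E[Y_m²])] -/
theorem lintegral_timarPop_sq_succ_le {a : ℝ≥0∞} (hθ : ∀ g x, θ g x ≤ a⁻¹)
    (hmean_le : ∀ g x, θ g x *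
      ∫⁻ ω, ((timarChildren G o (g * (n + 2)) n ρ x ω).encard : ℝ≥0∞) ∂(bondPercolation G p) ≤ 1)
    (g : ℕ) :
    ∫⁻ ω, timarPop G o n ρ θ ω (g + 1) ^ 2 ∂(bondPercolation G p) ≤
      ∫⁻ ω, timarPop G o n ρ θ ω g ^ 2 ∂(bondPercolation G p) +
        a⁻¹ * (graphBall G o ρ).encard * (graphBall G o (ρ + 1 + (ρ + 1))).encard * a⁻¹ ^ g *
          ∫⁻ ω, timarPop G o n ρ θ ω g ∂(bondPercolation G p) := by
  set P := bondPercolation G p with hP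
  set A : V → BondConfig V → ℝ≥0∞ := fun x ω => timarMass G o n ρ θ ω g x * θ g x *
    ((timarChildren G o (g * (n + 2)) n ρ x ω).encard : ℝ≥0∞) with hA
  have hmeasA : ∀ x, Measurable (A x) := fun x =>
    ((measurable_timarMass g x).mul_const _).mul (measurable_encard_timarChildren _ n ρ x)
  have hmeas_m : ∀ z, Measurable fun ω => timarMass G o n ρ θ ω g z := fun z => measurable_timarMass g z
  -- `E Y²_{g+1} = Σ_x Σ_y E[A_x A_y]`
  have hsq : ∫⁻ ω, timarPop G o n ρ θ ω (g + 1) ^ 2 ∂P = ∑' x, ∑' y, ∫⁻ ω, A x ω * A y ω ∂P := by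
    have h1 : ∀ ω, timarPop G o n ρ θ ω (g + 1) ^ 2 = ∑' x, ∑' y, A x ω * A y ω := fun ω => by
      rw [timarPop_succ]; exact ennreal_tsum_sq_eq _
    simp only [h1]
    have hAA : ∀ x y, Measurable fun ω => A x ω * A y ω := fun x y => (hmeasA x).mul (hmeasA y)
    have hsum : ∀ x, Measurable fun ω => ∑' y, A x ω * A y ω := fun x =>
      measurable_tsum_ennreal_of_countable (hAA x)
    rw [lintegral_tsum fun x => (hsum x).aemeasurable]
    exact tsum_congr fun x => lintegral_tsum fun y => (hAA x y).aemeasurable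
  -- `E Y²_g = Σ_x Σ_y E[m_x m_y]`
  have hsq' : ∫⁻ ω, timarPop G o n ρ θ ω g ^ 2 ∂P =
      ∑' x, ∑' y, ∫⁻ ω, timarMass G o n ρ θ ω g x * timarMass G o n ρ θ ω g y ∂P := by
    have h1 : ∀ ω, timarPop G o n ρ θ ω g ^ 2 =
        ∑' x, ∑' y, timarMass G o n ρ θ ω g x * timarMass G o n ρ θ ω g y := fun ω =>
      ennreal_tsum_sq_eq _
    simp only [h1]
    have hmm : ∀ x y, Measurable fun ω => timarMass G o n ρ θ ω g x * timarMass G o n ρ θ ω g y :=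
      fun x y => (hmeas_m x).mul (hmeas_m y)
    have hsum : ∀ x, Measurable fun ω =>
        ∑' y, timarMass G o n ρ θ ω g x * timarMass G o n ρ θ ω g y := fun x =>
      measurable_tsum_ennreal_of_countable (hmm x)
    rw [lintegral_tsum fun x => (hsum x).aemeasurable]
    exact tsum_congr fun x => lintegral_tsum fun y => (hmm x y).aemeasurable
  -- `E Y_g = Σ_x E m_x`
  have hlin : ∫⁻ ω, timarPop G o n ρ θ ω g ∂P = ∑' x, ∫⁻ ω, timarMass G o n ρ θ ω g x ∂P := by
    simp only [timarPop]
    exact lintegral_tsum fun x => (hmeas_m x).aemeasurable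
  rw [hsq, hsq', hlin, ← ENNReal.tsum_mul_left, ← ENNReal.tsum_add]
  refine ENNReal.tsum_le_tsum fun x => ?_
  -- the `y`-sum of the pair bounds
  calc ∑' y, ∫⁻ ω, A x ω * A y ω ∂P
      ≤ ∑' y, (∫⁻ ω, timarMass G o n ρ θ ω g x * timarMass G o n ρ θ ω g y ∂P +
          (graphBall G x (ρ + 1 + (ρ + 1))).indicator
            (fun _ => a⁻¹ * (graphBall G o ρ).encard * a⁻¹ ^ g *
              ∫⁻ ω, timarMass G o n ρ θ ω g x ∂P) y) :=
        ENNReal.tsum_le_tsum fun y => lintegral_pair_le hconn htr hU p hθ hmean_le g x y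
    _ = ∑' y, ∫⁻ ω, timarMass G o n ρ θ ω g x * timarMass G o n ρ θ ω g y ∂P +
          a⁻¹ * (graphBall G o ρ).encard * (graphBall G o (ρ + 1 + (ρ + 1))).encard * a⁻¹ ^ g *
            ∫⁻ ω, timarMass G o n ρ θ ω g x ∂P := by
        rw [ENNReal.tsum_add, tsum_indicator_const,
          encard_graphBall_eq_of_isGraphTransitive htr x o]
        ring

/-- **The branching construction survives with positive probability** ("Lemma 4.1 applies to
the random tree `T` defined above", p. 2356): if the weights satisfy `θ ≤ a⁻¹` with
`1 < a < ∞` and invert the mean offspring numbers on every generation's slab, then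
`P[Y_g ≠ 0 for all g] > 0`. Proof: the second-moment core of Lemma 4.1
(`measure_forall_ne_zero_pos_of_moments`) applied to `Z_g = a^g Y_g`, using the two recursions
above. [cite: Timar2006, Lemma 4.1 and §4 (proof of Thm. 4.3, last paragraph)] -/
theorem timarPop_pos_measure_forall_ne_zero {a : ℝ≥0∞} (ha : 1 < a) (haT : a ≠ ⊤)
    (hθ : ∀ g x, θ g x ≤ a⁻¹)
    (hmean : ∀ g x, x ∈ slab G o (g * (n + 2)) → θ g x *
      ∫⁻ ω, ((timarChildren G o (g * (n + 2)) n ρ x ω).encard : ℝ≥0∞) ∂(bondPercolation G p) = 1) :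
    0 < bondPercolation G p {ω | ∀ g, timarPop G o n ρ θ ω g ≠ 0} := by
  set P := bondPercolation G p with hP
  have ha0 : a ≠ 0 := (zero_lt_one.trans ha).ne'
  -- `θ E N ≤ 1` everywhere (`= 1` on the slab, `N = 0`-free bound off it is not needed: `m = 0` there)
  have hmean_le : ∀ g x, θ g x *
      ∫⁻ ω, ((timarChildren G o (g * (n + 2)) n ρ x ω).encard : ℝ≥0∞) ∂P ≤ 1 := by
    intro g x
    by_cases hx : x ∈ slab G o (g * (n + 2))
    · exact (hmean g x hx).le
    · have h0 : ∀ ω, timarChildren G o (g * (n + 2)) n ρ x ω = ∅ := fun ω =>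
        Set.eq_empty_of_forall_notMem fun c hc => hx (mem_slab_of_mem_timarChildren hc)
      simp only [h0, Set.encard_empty, ENat.toENNReal_zero, lintegral_const, zero_mul, mul_zero]
      exact zero_le_one
  -- the constants
  set M : ℝ≥0∞ := ((graphBall G o ρ).encard : ℝ≥0∞) with hM
  set α : ℝ≥0∞ := ((graphBall G o (ρ + 1 + (ρ + 1))).encard : ℝ≥0∞) with hα
  have hMT : M ≠ ⊤ := by
    rw [hM, (graphBall_finite G o ρ).encard_eq_coe_toFinset_card, ENat.toENNReal_coe]
    exact ENNReal.natCast_ne_top _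
  have hαT : α ≠ ⊤ := by
    rw [hα, (graphBall_finite G o _).encard_eq_coe_toFinset_card, ENat.toENNReal_coe]
    exact ENNReal.natCast_ne_top _
  -- `Z_g = a^g Y_g`
  set Z : ℕ → BondConfig V → ℝ≥0∞ := fun g ω => a ^ g * timarPop G o n ρ θ ω g with hZ
  have hZmeas : ∀ g, Measurable (Z g) := fun g => (measurable_timarPop g).const_mul _
  have hEY : ∀ g, ∫⁻ ω, timarPop G o n ρ θ ω g ∂P = 1 := lintegral_timarPop hconn htr hU p hmean
  have hEZ : ∀ g, ∫⁻ ω, Z g ω ∂P = a ^ g := fun g => by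
    simp only [hZ]; rw [lintegral_const_mul _ (measurable_timarPop g), hEY, mul_one]
  have hsurv := measure_forall_ne_zero_pos_of_moments P Z hZmeas (κ := a)
    (C := a⁻¹ * M * α * a ^ 2) ha haT
    (ENNReal.mul_ne_top (ENNReal.mul_ne_top (ENNReal.mul_ne_top (ENNReal.inv_ne_top.2 ha0) hMT) hαT)
      (ENNReal.pow_ne_top haT))
    (fun ω => by simp only [hZ, pow_zero, one_mul, timarPop_zero])
    (fun g => by rw [hEZ, hEZ, pow_succ, mul_comm])
    (fun g => by
      -- `E Z²_{g+1} = a^{2g+2} E Y²_{g+1} ≤ a² E Z_g² + C E Z_g`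
      have hmY : ∀ g, Measurable fun ω => timarPop G o n ρ θ ω g ^ 2 := fun g =>
        (measurable_timarPop (G := G) (o := o) (n := n) (ρ := ρ) (θ := θ) g).pow_const 2
      have h1 : ∫⁻ ω, Z (g + 1) ω ^ 2 ∂P =
          (a ^ (g + 1)) ^ 2 * ∫⁻ ω, timarPop G o n ρ θ ω (g + 1) ^ 2 ∂P := by
        simp only [hZ, mul_pow]
        exact lintegral_const_mul _ (hmY (g + 1))
      have h2 : ∫⁻ ω, Z g ω ^ 2 ∂P = (a ^ g) ^ 2 * ∫⁻ ω, timarPop G o n ρ θ ω g ^ 2 ∂P := by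
        simp only [hZ, mul_pow]
        exact lintegral_const_mul _ (hmY g)
      have hrec := lintegral_timarPop_sq_succ_le hconn htr hU p hθ hmean_le g
      rw [hEY, mul_one] at hrec
      have e1 : (a ^ (g + 1)) ^ 2 = a ^ 2 * (a ^ g) ^ 2 := by ring
      have e2 : (a ^ (g + 1)) ^ 2 * a⁻¹ ^ g = a ^ 2 * a ^ g := by
        rw [e1, sq (a ^ g), mul_assoc, mul_assoc, ← mul_pow, ENNReal.mul_inv_cancel ha0 haT,
          one_pow, mul_one]
      rw [h1, h2, hEZ]
      calc (a ^ (g + 1)) ^ 2 * ∫⁻ ω, timarPop G o n ρ θ ω (g + 1) ^ 2 ∂P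
          ≤ (a ^ (g + 1)) ^ 2 *
              (∫⁻ ω, timarPop G o n ρ θ ω g ^ 2 ∂P + a⁻¹ * M * α * a⁻¹ ^ g) := by gcongr
        _ = (a ^ (g + 1)) ^ 2 * ∫⁻ ω, timarPop G o n ρ θ ω g ^ 2 ∂P +
              a⁻¹ * M * α * ((a ^ (g + 1)) ^ 2 * a⁻¹ ^ g) := by ring
        _ = a ^ 2 * ((a ^ g) ^ 2 * ∫⁻ ω, timarPop G o n ρ θ ω g ^ 2 ∂P) +
              a⁻¹ * M * α * a ^ 2 * a ^ g := by rw [e2, e1]; ring)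
    (fun g ω h => by
      simp only [hZ] at h ⊢
      exact mul_ne_zero (pow_ne_zero _ ha0) (timarPop_ne_zero_of_succ (right_ne_zero_of_mul h)))
  -- `{∀ g, Z_g ≠ 0} = {∀ g, Y_g ≠ 0}`
  have hset : {ω | ∀ g, Z g ω ≠ 0} = {ω | ∀ g, timarPop G o n ρ θ ω g ≠ 0} := by
    ext ω
    simp only [Set.mem_setOf_eq, hZ]
    exact forall_congr' fun g => ⟨fun h => right_ne_zero_of_mul h,
      fun h => mul_ne_zero (pow_ne_zero _ ha0) h⟩
  rwa [hset] at hsurv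

end Moments

end Literature.Barriers.CriticalPhenomena

end
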